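import Summits.CriticalPhenomena.Ising3DConformalLimit.Theorems.HarmonicMomentsIsotropyDilutionTransferLatticeSumsB
import Literature.Probability.LatticeModels.PointwiseScalingLimitScaleCovariant
import Literature.Probability.LatticeModels.PointwiseScalingLimitSelfSimilar
import Literature.Probability.LatticeModels.CriticalScalingDimension

/-!
# Regular variation of the critical two-point mass, I: shell growth

Support file for item `DilutionTransfer` (stmt-CriticalPhenomena-6037) of route
`HarmonicMomentsIsotropy` (sub-problem `Ising3DConformalLimit`).

For a scale-covariant non-degenerate pointwise scaling limit `S` (renormalisation `ρ > 0` on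
`(0,1]`) of the critical correlators of the `ℤ³` Ising model:
* `tendsto_rho_sq_div` — `ρ(δ)²/ρ(δ/2)² → 2^{-2Δ}` (`δ → 0⁺`), and `8·2^{-2Δ} ≥ 2` as `Δ ≤ 1`
  (`scalingDimension_mem_Icc_holds`);
* `setIntegral_limitTwoPoint_pos`, `shellIntegral_pos` — the limit two-point function has positive
  integral over cubes / the unit cubic shell;
* `ballSum_eq_ballSum_two_mul_add_shellSum`, `ballSum_antitone` — bookkeeping of the lattice ball
  and shell sums `∑_{‖δx‖≤1} ⟨σ₀σₓ⟩_{β_c}`, `∑_{1/2<‖δx‖≤1} ⟨σ₀σₓ⟩_{β_c}`;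
* `shellSum_growth` — **geometric growth of the dyadic shell masses**: for small `δ`,
  `∑_{1/2<‖(δ/2)x‖≤1} ≥ (3/2) ∑_{1/2<‖δx‖≤1}` (Riemann sums `tendsto_rescaled_latticeSum` + the
  ratio limit).
This is the "Karamata" input of the planner's sketch of the item, derived (not assumed) from EX.
-/

noncomputable section

open MeasureTheory Filter Topology Set
open scoped ENNReal NNReal BigOperators
open Literature.Probability.LatticeModels

namespace Summit.CriticalPhenomena.Ising3DConformalLimit.Theorems.HarmonicMomentsIsotropy.LatticeSums

/-! ## Small filter helpers -/

/-- Unpacking an `∀ᶠ δ in 𝓝[>] 0`. -/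
theorem exists_of_eventually_nhdsGT {p : ℝ → Prop} (h : ∀ᶠ δ in 𝓝[>] (0 : ℝ), p δ) :
    ∃ δ₀ > 0, ∀ δ : ℝ, 0 < δ → δ < δ₀ → p δ := by
  rw [eventually_nhdsWithin_iff, Metric.eventually_nhds_iff] at h
  obtain ⟨δ₀, hδ₀, h⟩ := h
  exact ⟨δ₀, hδ₀, fun δ hδ hδδ₀ => h (by rw [Real.dist_eq, sub_zero, abs_of_pos hδ]; exact hδδ₀) hδ⟩

/-- Packing an `∀ᶠ δ in 𝓝[>] 0`. -/
theorem eventually_nhdsGT_of_forall {p : ℝ → Prop} {δ₀ : ℝ} (hδ₀ : 0 < δ₀)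
    (h : ∀ δ, 0 < δ → δ < δ₀ → p δ) : ∀ᶠ δ in 𝓝[>] (0 : ℝ), p δ := by
  rw [eventually_nhdsWithin_iff, Metric.eventually_nhds_iff]
  refine ⟨δ₀, hδ₀, fun δ hδ hpos => h δ hpos ?_⟩
  rw [Real.dist_eq, sub_zero, abs_of_pos hpos] at hδ
  exact hδ

/-- `δ ↦ δ/2` maps `0⁺` to `0⁺`. -/
theorem tendsto_half_nhdsGT : Tendsto (fun δ : ℝ => δ / 2) (𝓝[>] (0 : ℝ)) (𝓝[>] 0) := by
  refine tendsto_nhdsWithin_iff.2 ⟨?_, eventually_mem_nhdsWithin.mono fun δ hδ => by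
    simp only [mem_Ioi] at hδ ⊢; linarith⟩
  have h0 : Tendsto (fun δ : ℝ => δ / 2) (𝓝 0) (𝓝 (0 / 2)) := tendsto_id.div_const 2
  rw [zero_div] at h0
  exact h0.mono_left nhdsWithin_le_nhds

/-! ## The renormalisation ratio `ρ(δ)²/ρ(δ/2)² → 2^{-2Δ}` -/

/-- For a scale-covariant non-degenerate pointwise limit, `ρ(δ)² / ρ(δ/2)² → 2^{-2Δ}` (`δ → 0⁺`). -/
theorem tendsto_rho_sq_div {ρ : ℝ → ℝ} {Δ : ℝ} {S : CorrFamily 3}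
    (hlim : HasPointwiseScalingLimit (criticalCorr 3) ρ S) (hsc : IsScaleCovariant Δ S)
    (hnd : IsNondegenerateTwoPoint S) :
    Tendsto (fun δ => ρ δ ^ 2 / ρ (δ / 2) ^ 2) (𝓝[>] (0 : ℝ)) (𝓝 ((2 : ℝ) ^ (-(2 : ℝ) * Δ))) := by
  set x₀ : Fin 2 → EuclideanSpace ℝ (Fin 3) := ![0, EuclideanSpace.single (0 : Fin 3) (1 : ℝ)]
    with hx₀
  have hx₀nc : x₀ ∈ NonCoincident 3 2 := refPair_mem_nonCoincident (d := 3) (by norm_num)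
  have hS0 : 0 < S 2 x₀ := hnd _ hx₀nc
  set G : ℝ → ℝ := fun δ => criticalCorr 3 2 fun i => latticeApprox δ (x₀ i) with hG
  have h1 : Tendsto (fun δ => ρ δ ^ 2 * G δ) (𝓝[>] 0) (𝓝 (S 2 x₀)) := (hlim 2).tendsto_at hx₀nc
  have h2 : Tendsto (fun δ => ρ (1 / 2 * δ) ^ 2 * G δ) (𝓝[>] 0)
      (𝓝 (S 2 fun i => (1 / 2 : ℝ) • x₀ i)) := by
    have h := ((hlim.comp_smul (by norm_num : (0 : ℝ) < 1 / 2)) 2).tendsto_at hx₀nc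
    refine h.congr fun δ => ?_
    rw [rescaledCorrelator_apply]
  have hval : S 2 (fun i => (1 / 2 : ℝ) • x₀ i) = ((2 : ℝ) ^ (-(2 : ℝ) * Δ))⁻¹ * S 2 x₀ := by
    have h := hsc 2 (1 / 2) (by norm_num) x₀
    rw [h]
    congr 1
    rw [show ((2 : ℕ) : ℝ) = 2 by norm_num, one_div, Real.inv_rpow (by norm_num : (0 : ℝ) ≤ 2)]
  rw [hval] at h2
  have hpow : (0 : ℝ) < (2 : ℝ) ^ (-(2 : ℝ) * Δ) := Real.rpow_pos_of_pos (by norm_num) _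
  have hlim2 : ((2 : ℝ) ^ (-(2 : ℝ) * Δ))⁻¹ * S 2 x₀ ≠ 0 := mul_ne_zero (inv_ne_zero hpow.ne') hS0.ne'
  have hq := h1.div h2 hlim2
  have hv : S 2 x₀ / (((2 : ℝ) ^ (-(2 : ℝ) * Δ))⁻¹ * S 2 x₀) = (2 : ℝ) ^ (-(2 : ℝ) * Δ) := by
    field_simp
  rw [hv] at hq
  refine hq.congr' ?_
  have hev : ∀ᶠ δ : ℝ in 𝓝[>] 0, ρ (1 / 2 * δ) ^ 2 * G δ ≠ 0 := h2.eventually_ne hlim2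
  filter_upwards [hev] with δ hδ
  have hG0 : G δ ≠ 0 := fun h => hδ (by rw [h, mul_zero])
  simp only [Pi.div_apply]
  rw [mul_div_mul_right _ _ hG0, show 1 / 2 * δ = δ / 2 by ring]

/-- `8 · 2^{-2Δ} ≥ 2` for `Δ ≤ 1`. -/
theorem two_le_eight_mul_rpow {Δ : ℝ} (hΔ : Δ ≤ 1) : 2 ≤ 8 * (2 : ℝ) ^ (-(2 : ℝ) * Δ) := by
  have h1 : (2 : ℝ) ^ (-2 : ℝ) ≤ (2 : ℝ) ^ (-(2 : ℝ) * Δ) :=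
    Real.rpow_le_rpow_of_exponent_le (by norm_num) (by linarith)
  have h2 : (2 : ℝ) ^ (-2 : ℝ) = 1 / 4 := by
    rw [Real.rpow_neg (by norm_num), show (2 : ℝ) = ((2 : ℕ) : ℝ) by norm_num, Real.rpow_natCast]
    norm_num
  have h3 := mul_le_mul_of_nonneg_left h1 (by norm_num : (0 : ℝ) ≤ 8)
  rw [h2] at h3
  linarith

/-! ## Positivity of the limit integrals -/

/-- The integral of the limit two-point function over a cube of positive radius avoiding the
origin is positive. -/
theorem setIntegral_limitTwoPoint_pos {ρ : ℝ → ℝ} {S : CorrFamily 3}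
    (hlim : HasPointwiseScalingLimit (criticalCorr 3) ρ S) (hnd : IsNondegenerateTwoPoint S)
    {U K : Set (Fin 3 → ℝ)} (hK : IsCompact K) (h0 : (0 : Fin 3 → ℝ) ∉ K) (hUK : U ⊆ K)
    (hU : MeasurableSet U) {w : Fin 3 → ℝ} {r : ℝ} (hr : 0 < r) (hwU : Metric.closedBall w r ⊆ U) :
    0 < ∫ z in U, S 2 ![0, WithLp.toLp 2 z] := by
  obtain ⟨-, -, hint⟩ := limitTwoPoint_regular hlim hK h0
  have hpos : ∀ z ∈ U, 0 < S 2 ![0, WithLp.toLp 2 z] := by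
    intro z hz
    refine hnd _ (pair_mem_nonCoincident fun h => h0 (hUK ?_))
    have : z = 0 := by
      have h' := congrArg (WithLp.ofLp) h
      simpa using h'.symm
    rwa [← this]
  rw [setIntegral_pos_iff_support_of_nonneg_ae ?_ (hint.mono_set hUK)]
  · have hsub : Metric.closedBall w r ⊆ Function.support (fun z : Fin 3 → ℝ =>
        S 2 ![0, WithLp.toLp 2 z]) ∩ U :=
      fun z hz => ⟨(hpos z (hwU hz)).ne', hwU hz⟩
    refine lt_of_lt_of_le ?_ (measure_mono hsub)
    rw [Real.volume_pi_closedBall _ hr.le]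
    exact ENNReal.ofReal_pos.2 (by positivity)
  · rw [EventuallyLE, ae_restrict_iff' hU]
    exact Eventually.of_forall fun z hz => (hpos z hz).le

/-- The limit integral over the unit cubic shell `{1/2 < ‖z‖ ≤ 1}` is positive. -/
theorem shellIntegral_pos {ρ : ℝ → ℝ} {S : CorrFamily 3}
    (hlim : HasPointwiseScalingLimit (criticalCorr 3) ρ S) (hnd : IsNondegenerateTwoPoint S) :
    0 < ∫ z in Metric.closedBall (0 : Fin 3 → ℝ) 1 \ Metric.closedBall 0 (1 / 2),
      S 2 ![0, WithLp.toLp 2 z] := by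
  set K : Set (Fin 3 → ℝ) := Metric.closedBall 0 1 ∩ {z | 1 / 4 ≤ ‖z‖} with hK
  have hKc : IsCompact K := (isCompact_closedBall 0 1).inter_right (isClosed_le continuous_const
    continuous_norm)
  have h0K : (0 : Fin 3 → ℝ) ∉ K := by
    rintro ⟨-, h⟩; simp at h; linarith
  have hUK : Metric.closedBall (0 : Fin 3 → ℝ) 1 \ Metric.closedBall 0 (1 / 2) ⊆ K := by
    intro z hz
    rw [Set.mem_sdiff, Metric.mem_closedBall, Metric.mem_closedBall, dist_zero_right, not_le] at hz
    exact ⟨by rw [Metric.mem_closedBall, dist_zero_right]; exact hz.1, by simp; linarith [hz.2]⟩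
  -- a small cube inside the shell
  set w : Fin 3 → ℝ := fun _ => 3 / 4 with hw
  have hwn : ‖w‖ = 3 / 4 := by
    rw [hw]
    simp [Pi.norm_def, Finset.sup_const Finset.univ_nonempty]
  have hsub : Metric.closedBall w (1 / 8) ⊆
      Metric.closedBall (0 : Fin 3 → ℝ) 1 \ Metric.closedBall 0 (1 / 2) := by
    intro z hz
    rw [Metric.mem_closedBall, dist_eq_norm] at hz
    have h1 : ‖z‖ ≤ ‖z - w‖ + ‖w‖ := norm_le_norm_sub_add z w
    have h2 : ‖w‖ ≤ ‖w - z‖ + ‖z‖ := norm_le_norm_sub_add w z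
    rw [norm_sub_rev w z] at h2
    rw [Set.mem_sdiff, Metric.mem_closedBall, Metric.mem_closedBall, dist_zero_right, not_le]
    constructor <;> linarith
  exact setIntegral_limitTwoPoint_pos hlim hnd hKc h0K hUK
    (measurableSet_closedBall.diff measurableSet_closedBall) (by norm_num) hsub

/-! ## Lattice shell and ball sums of the critical two-point function -/

open scoped Classical in
/-- Splitting the ball sum at mesh `δ`: `∑_{‖δx‖≤1} = ∑_{‖2δx‖≤1} + ∑_{1/2<‖δx‖≤1}`. -/
theorem ballSum_eq_ballSum_two_mul_add_shellSum {δ : ℝ} (hδ : 0 < δ) :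
    (∑' x : Site 3, if (δ • fun i => ((x i : ℤ) : ℝ)) ∈ Metric.closedBall (0 : Fin 3 → ℝ) 1
        then criticalTwoPoint 3 x else 0) =
      (∑' x : Site 3, if ((2 * δ) • fun i => ((x i : ℤ) : ℝ)) ∈ Metric.closedBall (0 : Fin 3 → ℝ) 1
        then criticalTwoPoint 3 x else 0) +
      ∑' x : Site 3, (if (δ • fun i => ((x i : ℤ) : ℝ)) ∈
          Metric.closedBall (0 : Fin 3 → ℝ) 1 \ Metric.closedBall 0 (1 / 2)
        then criticalTwoPoint 3 x else 0) := by
  classical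
  have h2δ : 0 < 2 * δ := by linarith
  rw [← Summable.tsum_add (summable_norm_ite_mem h2δ subset_rfl _).of_norm
    (summable_norm_ite_mem hδ sdiff_subset _).of_norm]
  refine tsum_congr fun x => ?_
  have hnorm : ‖((2 * δ) • fun i => ((x i : ℤ) : ℝ))‖ = 2 * ‖(δ • fun i => ((x i : ℤ) : ℝ))‖ := by
    rw [mul_smul, norm_smul, Real.norm_eq_abs, abs_of_pos two_pos]
  simp only [Metric.mem_closedBall, dist_zero_right, Set.mem_sdiff, not_le, hnorm]
  by_cases h1 : ‖(δ • fun i => ((x i : ℤ) : ℝ))‖ ≤ 1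
  · by_cases h2 : ‖(δ • fun i => ((x i : ℤ) : ℝ))‖ ≤ 1 / 2
    · rw [if_pos h1, if_pos (by linarith), if_neg (fun h => absurd h2 (not_le.2 h.2)), add_zero]
    · rw [if_pos h1, if_neg (by linarith), if_pos ⟨h1, not_le.1 h2⟩, zero_add]
  · rw [if_neg h1, if_neg (by push Not at h1; linarith), if_neg (fun h => h1 h.1), add_zero]

open scoped Classical in
/-- Monotonicity of the ball sum in the mesh: `δ ≤ δ'` gives `∑_{‖δ'x‖≤1} ≤ ∑_{‖δx‖≤1}`. -/
theorem ballSum_antitone {δ δ' : ℝ} (hδ : 0 < δ) (hδδ' : δ ≤ δ') :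
    (∑' x : Site 3, if (δ' • fun i => ((x i : ℤ) : ℝ)) ∈ Metric.closedBall (0 : Fin 3 → ℝ) 1
        then criticalTwoPoint 3 x else 0) ≤
      ∑' x : Site 3, (if (δ • fun i => ((x i : ℤ) : ℝ)) ∈ Metric.closedBall (0 : Fin 3 → ℝ) 1
        then criticalTwoPoint 3 x else 0) := by
  classical
  have hδ' : 0 < δ' := lt_of_lt_of_le hδ hδδ'
  refine Summable.tsum_le_tsum (fun x => ?_) (summable_norm_ite_mem hδ' subset_rfl _).of_norm
    (summable_norm_ite_mem hδ subset_rfl _).of_norm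
  simp only [Metric.mem_closedBall, dist_zero_right, norm_smul, Real.norm_eq_abs, abs_of_pos hδ,
    abs_of_pos hδ']
  by_cases h : δ' * ‖fun i => ((x i : ℤ) : ℝ)‖ ≤ 1
  · rw [if_pos h, if_pos]
    exact le_trans (mul_le_mul_of_nonneg_right hδδ' (norm_nonneg _)) h
  · rw [if_neg h]
    split_ifs
    · exact criticalTwoPoint_nonneg' x
    · exact le_refl _

/-- The shell sums are nonnegative. -/
theorem shellSum_nonneg (δ : ℝ) (U : Set (Fin 3 → ℝ)) [DecidablePred (· ∈ U)] :
    0 ≤ ∑' x : Site 3, (if (δ • fun i => ((x i : ℤ) : ℝ)) ∈ U then criticalTwoPoint 3 x else 0) :=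
  tsum_nonneg fun x => by split_ifs; exacts [criticalTwoPoint_nonneg' x, le_refl _]

/-! ## Geometric growth of the shell sums -/

open scoped Classical in
/-- **Shell growth**: under a scale-covariant non-degenerate pointwise limit, for small mesh the
half-mesh shell sum dominates: `(3/2) ∑_{1/2<‖δx‖≤1} ≤ ∑_{1/2<‖δx/2‖≤1}`, i.e. the critical two-point
mass of the dyadic shell at scale `2T` is at least `3/2` times that at scale `T` (the limit ratio is
`2^{3-2Δ} ≥ 2`, `Δ ≤ 1` by `scalingDimension_mem_Icc_holds`). -/
theorem shellSum_growth {ρ : ℝ → ℝ} {Δ : ℝ} {S : CorrFamily 3}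
    (hρ : ∀ δ ∈ Set.Ioc (0 : ℝ) 1, 0 < ρ δ)
    (hlim : HasPointwiseScalingLimit (criticalCorr 3) ρ S) (hsc : IsScaleCovariant Δ S)
    (hnd : IsNondegenerateTwoPoint S) :
    ∃ δ₀ > 0, ∀ δ : ℝ, 0 < δ → δ < δ₀ →
      (3 / 2 : ℝ) * (∑' x : Site 3, if (δ • fun i => ((x i : ℤ) : ℝ)) ∈
          Metric.closedBall (0 : Fin 3 → ℝ) 1 \ Metric.closedBall 0 (1 / 2)
          then criticalTwoPoint 3 x else 0) ≤
        ∑' x : Site 3, (if ((δ / 2) • fun i => ((x i : ℤ) : ℝ)) ∈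
          Metric.closedBall (0 : Fin 3 → ℝ) 1 \ Metric.closedBall 0 (1 / 2)
          then criticalTwoPoint 3 x else 0) := by
  classical
  set U : Set (Fin 3 → ℝ) := Metric.closedBall (0 : Fin 3 → ℝ) 1 \ Metric.closedBall 0 (1 / 2)
    with hU
  set sh : ℝ → ℝ := fun δ => ∑' x : Site 3,
    (if (δ • fun i => ((x i : ℤ) : ℝ)) ∈ U then criticalTwoPoint 3 x else 0) with hsh
  set I₁ : ℝ := ∫ z in U, S 2 ![0, WithLp.toLp 2 z] with hI₁
  have hI₁ : 0 < I₁ := shellIntegral_pos hlim hnd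
  have hΔ : Δ ≤ 1 := (scalingDimension_mem_Icc_holds ρ Δ S hlim hsc hnd hρ).2
  -- the three limits
  have hA : Tendsto (fun δ => δ ^ 3 * ρ δ ^ 2 * sh δ) (𝓝[>] 0) (𝓝 I₁) :=
    tendsto_rescaled_latticeSum hlim 0 (a := 1 / 2) (b := 1) (η := 1 / 4) (by norm_num)
      (Or.inr (by rw [norm_zero]; norm_num))
  have hA2 : Tendsto (fun δ => (δ / 2) ^ 3 * ρ (δ / 2) ^ 2 * sh (δ / 2)) (𝓝[>] 0) (𝓝 I₁) :=
    hA.comp tendsto_half_nhdsGT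
  have hR := tendsto_rho_sq_div hlim hsc hnd
  set L : ℝ := (2 : ℝ) ^ (-(2 : ℝ) * Δ) with hL
  have hL2 : 2 ≤ 8 * L := two_le_eight_mul_rpow hΔ
  have hΦ : Tendsto (fun δ => 8 * ((δ / 2) ^ 3 * ρ (δ / 2) ^ 2 * sh (δ / 2)) *
      (ρ δ ^ 2 / ρ (δ / 2) ^ 2) - 3 / 2 * (δ ^ 3 * ρ δ ^ 2 * sh δ)) (𝓝[>] 0)
      (𝓝 (8 * I₁ * L - 3 / 2 * I₁)) := ((hA2.const_mul 8).mul hR).sub (hA.const_mul (3 / 2))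
  have hpos : 0 < 8 * I₁ * L - 3 / 2 * I₁ := by nlinarith
  have hev := hΦ.eventually_const_lt hpos
  have hIoc : ∀ᶠ δ : ℝ in 𝓝[>] 0, δ < 1 := by
    exact eventually_nhdsGT_of_forall one_pos fun δ _ h => h
  obtain ⟨δ₀, hδ₀, h⟩ := exists_of_eventually_nhdsGT (hev.and hIoc)
  refine ⟨δ₀, hδ₀, fun δ hδ hδδ₀ => ?_⟩
  obtain ⟨hΦδ, hδ1⟩ := h δ hδ hδδ₀
  have hρδ : 0 < ρ δ := hρ δ ⟨hδ, hδ1.le⟩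
  have hρδ2 : 0 < ρ (δ / 2) := hρ (δ / 2) ⟨by linarith, by linarith⟩
  -- unfold the positive quantity
  have hkey : 0 < δ ^ 3 * ρ δ ^ 2 * (sh (δ / 2) - 3 / 2 * sh δ) := by
    have e : 8 * ((δ / 2) ^ 3 * ρ (δ / 2) ^ 2 * sh (δ / 2)) * (ρ δ ^ 2 / ρ (δ / 2) ^ 2) -
        3 / 2 * (δ ^ 3 * ρ δ ^ 2 * sh δ) = δ ^ 3 * ρ δ ^ 2 * (sh (δ / 2) - 3 / 2 * sh δ) := by
      field_simp
      ring
    rw [← e]; exact hΦδ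
  have hfac : 0 < δ ^ 3 * ρ δ ^ 2 := by positivity
  have := (mul_pos_iff_of_pos_left hfac).1 hkey
  linarith

end Summit.CriticalPhenomena.Ising3DConformalLimit.Theorems.HarmonicMomentsIsotropy.LatticeSums

end
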